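import Literature.Computability.FineGrained.CliqueETHReductionProgram
import Literature.Computability.FineGrained.KOVSplitInstance
import HarnessLib

/-!
# SETH ⇒ `k`-OV: the word-RAM program of the split-and-list reduction

The program behind the named fact `sparseKSATInRAMTime_of_kOV_inTimeO` of
`…FineGrained.KOVFromSETH` (V. Vassilevska Williams, ICM 2018, §3, Thm. 3.1, after R. Williams,
TCS 348 (2005), §5.1: an `O(N^{k-ε})` algorithm for `k`-OV in dimension `c log N` decides sparse
CNF-SAT in time `2^{(1-ε/k) n}`), written as structured word-RAM code (`SProg` of
`…WordRAMStructured`, verified in the logic `SProg.Achieves` of `…WordRAMAchieves`) around one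
emulated run of the hypothetical `k`-OV program (`SProg.withSubrun` of `…WordRAMSubrun`), and the
proof that its *build* phase computes, in closed form, the memory presenting the `kOV k` encoding
of the split instance (`splitInstance` of `…KOVSplitInstance`) to the emulator. The conventions,
register layout and proof technique are those of the clique reduction
(`…CliqueETHReductionProgram`, whose generic pieces — the size loop, the register clearing, the
read-out, the block rule `achieves_block_of_eq` — are reused verbatim).

* **The program** (`KOVRed.pre k c kM cM`, `KOVRed.reduction`): relocate the input
  (`SProg.relocate`); compute `n, m, g = ⌊n/k⌋ + 1, N = 2^g, d = c g, N d, L_y = k N d + 2` and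
  the base `Bv` of the emulated cells (`setup1`), the emulated word size `ws = kM · size L_y` by
  the halving loop (`CliqueRed.sizeLoop`) and the emulator's environment registers (`setup3`);
  fill the `k` tables of the split instance into the emulated cells — for every list `l < k`,
  every assignment `a < N` and every clause `j < m`, walk the literals of clause `j` in the
  relocated input, test for one on a variable of group `l` made true by `a`, and write the bit
  "none" (reduced modulo `2^ws`) into emulated cell `3 + (l N + a) d + j` (`fill`, loops `listBody`
  ⊃ `rowBody` ⊃ `clauseBody` ⊃ `litBody`; padding cells stay `0`); write the header `L_y, N, d`
  (`header`); clear the scratch registers (`CliqueRed.clearRegs`); after the emulated run,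
  `CliqueRed.post` copies the `k`-OV program's answer bit to the output.
* **Ghost parameters** (`KOVRed.Params` with `x, Lx, X, n, m, G, N, d, Nd, Ly, Bv, ws, Pw, V, Sv,
  env`), the word-size requirement `Params.Fits W`, and the intended memory contents stage by stage
  (`cellVal`, `fillData`, `ycell`, `finData`, `finMem`).
* **Verification**, phase by phase, by symbolic execution of straight-line blocks and the counted
  while rule: `setup1_spec`, `setup3_spec`, `litBody_loop`, `clauseBody_spec`, `rowBody_spec`,
  `listBody_spec`, `fill_spec`, and finally **`Params.pre_spec`**: on the initial memory of
  `x = encodeCNFWords φ` (word size `W` with `Fits W`, `k ≥ 1`, `c ≥ 1`, `m ≤ d`) the build ends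
  within `Params.Tpre` steps in exactly the memory `Params.finMem`.

## References

* V. Vassilevska Williams, *On some fine-grained questions in algorithms and complexity*,
  Proc. ICM 2018, §2 (the word RAM; algorithms calling an algorithm for another problem) and §3,
  Thm. 3.1 (proof).
* R. Williams, *A new algorithm for optimal 2-constraint satisfaction and its implications*,
  Theoret. Comput. Sci. 348 (2005), §5.1.
* T. Nipkow, G. Klein, *Concrete Semantics with Isabelle/HOL*, Springer 2014, §12 (verification
  of `WHILE` programs by invariants).
-/


namespace Literature.Computability.FineGrained

open Cryptography Cryptography.WordRAM Complexity Cryptography.WordRAM.SProg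
open CliqueRed (r pt im lay achieves_block_of_eq)

namespace KOVRed

/-! ### Register map

`0 = X` (base of the relocated input, `x[j]` in cell `X + j`), `1 = X - 1` (set by `relocate`);
`2 = n`, `3 = m`, `4 = g` (group length), `5 = N = 2^g`, `6 = d = c g`, `7 = N d`,
`8 = L_y = k N d + 2`, `10 = Bv` (base of the emulated cells); the emulator's layout
`10 = Bv`, `11 = Sv`, `12 = Gv (= 0)`, `13 = Pw = 2^ws`, temporaries `14, 15, 16`; `17` post;
scratch `20–25` (setup); loop registers `30 = l`, `31 = k - l`, `32 = a`, `33 = N - a`,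
`34 =` clause pointer, `35 = j`, `36 = m - j`, `37 =` clause length, `38 =` flag "some literal so
far is satisfying", `39 =` literal pointer, `40 =` literals left, `41–49` temporaries, `50 =` row
base. -/

/-! ### Setup: the constants -/

/-- Setup, part 1: `n, m, g, N, d, N d, L_y, Bv`, then `r21 := L_y`, `r22 := 0`. [folklore] -/
def setup1 (k c : ℕ) : SProg := block [
  (.band, r 2, pt 0, pt 0),
  (.add, r 20, r 0, im 1), (.band, r 3, pt 20, pt 20),
  (.div, r 4, r 2, im k), (.add, r 4, r 4, im 1),
  (.shl, r 5, im 1, r 4),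
  (.mul, r 6, r 4, im c),
  (.mul, r 7, r 5, r 6),
  (.mul, r 8, r 7, im k), (.add, r 8, r 8, im 2),
  (.sub, r 20, r 1, im 100), (.add, r 10, r 1, r 20), (.add, r 10, r 10, im 1),
  (.band, r 21, r 8, r 8), (.band, r 22, im 0, im 0)]

/-- Setup, part 3: `ws := kM · size`, `Pw := 2^ws`, and `r23 := max (Pw - 1) (max cM L_y)`
(`cM` the largest constant of the `k`-OV program), `Sv := Bv + r23 + 1`, `Gv := 0`. [folklore] -/
def setup3 (kM cM : ℕ) : SProg := seqs [
  block [(.mul, r 22, r 22, im kM), (.shl, r 13, im 1, r 22), (.sub, r 23, r 13, im 1),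
    (.lt, r 24, r 23, im cM)],
  ifz (r 24) skip (block [(.band, r 23, im cM, im cM)]),
  block [(.band, r 25, r 8, r 8), (.lt, r 24, r 23, r 25)],
  ifz (r 24) skip (block [(.band, r 23, r 25, r 25)]),
  block [(.add, r 11, r 10, r 23), (.add, r 11, r 11, im 1), (.band, r 12, im 0, im 0)]]

/-! ### The tables of the split instance -/

/-- One literal of the current clause: decode it, test "its variable lies in group `l` and
receives its polarity from the assignment `a`", OR the test bit into the flag `r38` (disjunction of
bits `u`, `v` as `[[u = 0] ∧ [v = 0] < 1]`, using only the overflow-free `eq`/`band`/`lt`: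
`CliqueRed.or_toNat`); advance. [folklore] -/
def litBody : SProg := block [
  (.band, r 41, pt 39, pt 39),
  (.shr, r 42, r 41, im 1),
  (.band, r 43, r 41, im 1),
  (.div, r 44, r 42, r 4),
  (.mod, r 45, r 42, r 4),
  (.shr, r 45, r 32, r 45), (.band, r 45, r 45, im 1),
  (.eq, r 46, r 44, r 30),
  (.eq, r 47, r 45, r 43),
  (.band, r 46, r 46, r 47),
  (.eq, r 47, r 38, im 0), (.eq, r 46, r 46, im 0), (.band, r 46, r 46, r 47),
  (.lt, r 38, r 46, im 1),
  (.add, r 39, r 39, im 1), (.sub, r 40, r 40, im 1)]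

/-- One clause `j` of the current row: read its length, test its literals, write the bit "no
satisfying literal" (reduced modulo `Pw`) into emulated cell `3 + (l N + a) d + j`; advance the
clause pointer. [folklore] -/
def clauseBody : SProg := seqs [
  block [(.band, r 37, pt 34, pt 34), (.band, r 38, im 0, im 0), (.add, r 39, r 34, im 1),
    (.band, r 40, r 37, r 37)],
  whilenz (r 40) litBody,
  block [(.eq, r 48, r 38, im 0), (.mod, r 48, r 48, r 13), (.add, r 49, r 50, r 35),
    (.band, pt 49, r 48, r 48), (.band, r 34, r 39, r 39), (.add, r 35, r 35, im 1),
    (.sub, r 36, r 36, im 1)]]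

/-- One row (the vector of assignment `a` of list `l`): reset the clause pointer, compute the
row base `Bv + 3 + (l N + a) d`, process the `m` clauses; advance `a`. [folklore] -/
def rowBody : SProg := seqs [
  block [(.add, r 34, r 0, im 2), (.band, r 35, im 0, im 0), (.band, r 36, r 3, r 3),
    (.mul, r 50, r 30, r 5), (.add, r 50, r 50, r 32), (.mul, r 50, r 50, r 6),
    (.add, r 50, r 50, im 3), (.add, r 50, r 50, r 10)],
  whilenz (r 36) clauseBody,
  block [(.add, r 32, r 32, im 1), (.sub, r 33, r 33, im 1)]]

/-- One list `l`: its `N` rows; advance `l`. [folklore] -/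
def listBody : SProg := seqs [
  block [(.band, r 32, im 0, im 0), (.band, r 33, r 5, r 5)],
  whilenz (r 33) rowBody,
  block [(.add, r 30, r 30, im 1), (.sub, r 31, r 31, im 1)]]

/-- The `k` tables of the split instance, in the emulated memory. [folklore] -/
def fill (k : ℕ) : SProg := seqs [
  block [(.band, r 30, im 0, im 0), (.band, r 31, im k, im k)],
  whilenz (r 31) listBody]

/-! ### Header, the build, the reduction -/

/-- The header of the emulated input: cells `0, 1, 2` hold `L_y`, `N`, `d` (mod `Pw`).
[folklore] -/
def header : SProg := block [
  (.mod, r 20, r 8, r 13), (.band, pt 10, r 20, r 20),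
  (.mod, r 20, r 5, r 13), (.add, r 21, r 10, im 1), (.band, pt 21, r 20, r 20),
  (.mod, r 20, r 6, r 13), (.add, r 21, r 10, im 2), (.band, pt 21, r 20, r 20)]

/-- **The build**: relocate the input, compute the constants, fill the tables and the header of the
emulated `kOV k` input, clear the scratch. (`k` lists, dimension constant `c`; `kM`, `cM`:
word-size constant and largest constant of the `k`-OV program.) [folklore] -/
def pre (k c kM cM : ℕ) : SProg := seqs [
  relocate, setup1 k c, CliqueRed.sizeLoop, setup3 kM cM, fill k, header, CliqueRed.clearRegs]

/-- **The reduction program**: sparse CNF-SAT by one emulated run of the `k`-OV program `M`.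
[folklore] -/
def reduction (M : Program) (k c kM : ℕ) : Program :=
  withSubrun (pre k c kM M.maxConst) lay M CliqueRed.post

/-- The build is query-free. [folklore] -/
theorem pre_queryFree (k c kM cM : ℕ) : (pre k c kM cM).QueryFree := by
  refine seqs_queryFree ?_
  simp only [List.mem_cons, List.not_mem_nil, or_false]
  rintro s (rfl | rfl | rfl | rfl | rfl | rfl | rfl)
  · exact relocate_queryFree
  · exact block_queryFree _
  · exact block_queryFree _
  · refine seqs_queryFree ?_
    simp only [List.mem_cons, List.not_mem_nil, or_false]
    rintro s (rfl | rfl | rfl | rfl | rfl)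
    · exact block_queryFree _
    · exact ⟨trivial, block_queryFree _⟩
    · exact block_queryFree _
    · exact ⟨trivial, block_queryFree _⟩
    · exact block_queryFree _
  · simp [fill, listBody, rowBody, clauseBody, litBody, seqs, QueryFree, block_queryFree]
  · exact block_queryFree _
  · exact block_queryFree _

/-- The reduction program is deterministic. [folklore] -/
theorem reduction_isDeterministic (M : Program) (k c kM : ℕ) :
    (reduction M k c kM).IsDeterministic :=
  withSubrun_isDeterministic _ _ _ _

/-- The reduction program is oracle-free. [folklore] -/
theorem reduction_isOracleFree (M : Program) (k c kM : ℕ) : (reduction M k c kM).IsOracleFree :=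
  withSubrun_isOracleFree (pre_queryFree _ _ _ _) CliqueRed.post_queryFree _ _

/-! ### Ghost parameters of a run -/

/-- The data of a run of the reduction: the formula, the number of lists `k`, the dimension
constant `c`, and the word-size constant `kM` and largest constant `cM` of the `k`-OV program.
[folklore] -/
structure Params where
  /-- The input formula. -/
  φ : CNF ℕ
  /-- The number of lists. -/
  k : ℕ
  /-- The dimension constant (`d = c g`). -/
  c : ℕ
  /-- The word-size constant of the `k`-OV program. -/
  kM : ℕ
  /-- The largest constant of the `k`-OV program. -/
  cM : ℕ

namespace Params

variable (g : Params)

/-- The input words. [folklore] -/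
def x : List ℕ := encodeCNFWords g.φ
/-- The input length `Lx`. [folklore] -/
def Lx : ℕ := g.x.length
/-- The base `X` of the relocated input: `x[j]` sits in cell `X + j`. [folklore] -/
def X : ℕ := g.Lx + 101
/-- The number of variables. [folklore] -/
def n : ℕ := g.φ.numVars
/-- The number of clauses. [folklore] -/
def m : ℕ := g.φ.length
/-- The group length `g = ⌊n/k⌋ + 1`. [folklore] -/
def G : ℕ := grpLen g.n g.k
/-- The number of vectors per list `N = 2^g`. [folklore] -/
def N : ℕ := 2 ^ g.G
/-- The dimension `d = c g`. [folklore] -/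
def d : ℕ := g.c * g.G
/-- The size `N d` of one table. [folklore] -/
def Nd : ℕ := g.N * g.d
/-- The length `L_y = k N d + 2` of the emulated input. [folklore] -/
def Ly : ℕ := g.Nd * g.k + 2
/-- Base of the emulated cells (right after the relocated input). [folklore] -/
def Bv : ℕ := g.X + g.Lx
/-- The emulated word size `ws = kM · size L_y`. [folklore] -/
def ws : ℕ := g.kM * Nat.size g.Ly
/-- The emulated modulus `Pw = 2^ws`. [folklore] -/
def Pw : ℕ := 2 ^ g.ws
/-- The value bound `V = max (Pw - 1) (max cM L_y)` of the emulation. [folklore] -/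
def V : ℕ := max (g.Pw - 1) (max g.cM g.Ly)
/-- Base of the stamps. [folklore] -/
def Sv : ℕ := g.Bv + g.V + 1
/-- The emulator environment: cells at `Bv`, stamps at `Sv`, generation `0`, word size `ws`,
region size `V + 1`. [folklore] -/
def env : Env := ⟨g.Bv, g.Sv, 0, g.ws, g.V + 1⟩

/-- The chain of bases. [folklore] -/
theorem bases : 100 < g.X ∧ g.X + g.Lx = g.Bv ∧ g.Bv + g.V + 1 = g.Sv := by
  refine ⟨by unfold X; omega, rfl, rfl⟩

/-- `2 ≤ Lx`: the encoding starts with `numVars, numClauses`. [folklore] -/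
theorem two_le_Lx : 2 ≤ g.Lx := by
  unfold Lx x; rw [length_encodeCNFWords_eq]; omega

/-- `m + 2 ≤ Lx`. [folklore] -/
theorem m_add_two_le_Lx : g.m + 2 ≤ g.Lx := by
  unfold Lx x m; rw [length_encodeCNFWords_eq, CNF.numClauses]; omega

/-- `2 ≤ N`. [folklore] -/
theorem two_le_N : 2 ≤ g.N := by
  unfold N
  calc 2 = 2 ^ 1 := rfl
    _ ≤ 2 ^ g.G := Nat.pow_le_pow_right Nat.two_pos (Nat.succ_le_succ (Nat.zero_le _))

/-- `1 ≤ d` for `c ≥ 1`. [folklore] -/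
theorem one_le_d (hc : 1 ≤ g.c) : 1 ≤ g.d :=
  Nat.one_le_iff_ne_zero.2 (Nat.mul_ne_zero (by omega) (Nat.succ_ne_zero _))

/-- `L_y ≤ V`, `cM ≤ V`, `Pw - 1 ≤ V`. [folklore] -/
theorem le_V : g.Ly ≤ g.V ∧ g.cM ≤ g.V ∧ g.Pw - 1 ≤ g.V :=
  ⟨le_max_of_le_right (le_max_right _ _), le_max_of_le_right (le_max_left _ _), le_max_left _ _⟩

/-- The split instance of the run. [folklore] -/
theorem N_eq : g.N = (splitInstance g.φ g.k g.c).n := rfl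

/-- The dimension of the run is that of the split instance. [folklore] -/
theorem d_eq : g.d = (splitInstance g.φ g.k g.c).d := rfl

/-- **Word-size requirements** of a run at word size `W`: the stamps fit (`Sv + V + 1 ≤ 2 ^ W`,
whence every address and every value fits), the emulated word size is below `W`, and the input
width is at most `W` (so the input is stored exactly). [folklore] -/
structure Fits (W : ℕ) : Prop where
  top : g.Sv + g.V + 1 ≤ 2 ^ W
  ws_lt : g.ws < W
  width : inputWidth g.x ≤ W

/-- Under `Fits`, the input words fit. [folklore] -/
theorem Fits.input {g : Params} {W : ℕ} (h : g.Fits W) : ∀ v ∈ g.x, v < 2 ^ W := fun v hv =>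
  lt_of_lt_of_le (lt_two_pow_inputWidth_of_mem g.x v hv) (Nat.pow_le_pow_right Nat.two_pos h.width)

/-- The word-size requirement is monotone in the word size. [folklore] -/
theorem Fits.mono {g : Params} {W W' : ℕ} (h : g.Fits W) (hW : W ≤ W') : g.Fits W' :=
  ⟨h.top.trans (Nat.pow_le_pow_right (by norm_num) hW), lt_of_lt_of_le h.ws_lt hW, h.width.trans hW⟩

/-! ### Products: rows and cells -/

/-- Row `l N + a` lies below `k N`. [folklore] -/
theorem row_lt {l a : ℕ} (hl : l < g.k) (ha : a < g.N) : l * g.N + a < g.k * g.N :=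
  calc l * g.N + a < l * g.N + g.N := Nat.add_lt_add_left ha _
    _ = (l + 1) * g.N := (Nat.succ_mul _ _).symm
    _ ≤ g.k * g.N := Nat.mul_le_mul_right _ hl

/-- The cells of row `r < k N` lie below `k N d = L_y - 2`. [folklore] -/
theorem row_cells_le {ρ : ℕ} (hρ : ρ < g.k * g.N) : ρ * g.d + g.d ≤ g.Nd * g.k := by
  calc ρ * g.d + g.d = (ρ + 1) * g.d := (Nat.succ_mul _ _).symm
    _ ≤ (g.k * g.N) * g.d := Nat.mul_le_mul_right _ hρ
    _ = g.Nd * g.k := by unfold Nd; ring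

/-! ### The values of the emulated cells -/

/-- The value of emulated table cell `q = (l N + a) d + j` (cell `3 + q` of the emulated input):
the bit `vecB l a j`, reduced modulo the emulated modulus. [folklore] -/
def cellVal (q : ℕ) : ℕ :=
  (vecB g.φ g.G (q / g.d / g.N) (q / g.d % g.N) (q % g.d)).toNat % g.Pw

/-- The emulated input: the `kOV k` encoding of the split instance. [folklore] -/
noncomputable def y : List ℕ := (kOV g.k).encode (splitInstance g.φ g.k g.c)

/-- Emulated cell `i` of the initial memory of the `k`-OV program on `y` (word size `ws`):
`|y|` in cell `0`, `y[i - 1]` in cell `i`, reduced modulo `Pw`, and `0` past the input.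
[folklore] -/
noncomputable def ycell (i : ℕ) : ℕ :=
  if i = 0 then g.Ly % g.Pw else (g.y.getD (i - 1) 0) % g.Pw

/-! ### The intended data memory, stage by stage

All stages agree below `Bv + 3` with the relocated input `relocated x` (which vanishes from
`Bv = X + Lx` on); the stage parameters `(ρ, j)` say that the rows `< ρ` and the first `j` cells
of row `ρ` of the tables have been written (padding cells are `0` whether written or not). -/

/-- Data after the rows `< ρ` and `j` cells of row `ρ`. [folklore] -/
def fillData (ρ j a : ℕ) : ℕ :=
  if a < g.Bv + 3 then relocated g.x a
  else if a - (g.Bv + 3) < ρ * g.d + j then g.cellVal (a - (g.Bv + 3)) else 0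

/-- The final data: the relocated input and the emulated input `y` (header and tables).
[folklore] -/
noncomputable def finData (a : ℕ) : ℕ :=
  if a < g.Bv then relocated g.x a
  else if a < g.Bv + (g.Ly + 1) then g.ycell (a - g.Bv)
  else 0

/-- **The final memory of the build**: registers `10–13` hold `Bv, Sv, 0, Pw`, every other
register is `0`, and the data is `finData`. [folklore] -/
noncomputable def finMem (a : ℕ) : ℕ :=
  if a < 100 then (if a = 10 then g.Bv else if a = 11 then g.Sv else if a = 13 then g.Pw else 0)
  else g.finData a

end Params

end KOVRed

end Literature.Computability.FineGrained

namespace Literature.Computability.FineGrained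

open Cryptography Cryptography.WordRAM Complexity Cryptography.WordRAM.SProg
open CliqueRed (r pt im lay achieves_block_of_eq ite_and_ite ite_eq_toNat_decide toNat_and_toNat
  shiftRight_and_one litCode_shiftRight_one litCode_and_one)

namespace KOVRed

/-! ### Bit arithmetic of the literal test -/

/-- Comparing two bits with `eq` gives the bit of their Boolean equality. [folklore] -/
theorem ite_toNat_eq_toNat (u v : Bool) : (if u.toNat = v.toNat then 1 else 0 : ℕ) = (u == v).toNat := by
  cases u <;> cases v <;> rfl

/-- The final test `[flag = 0]` is the negated flag. [folklore] -/
theorem ite_toNat_eq_zero (u : Bool) : (if u.toNat = 0 then 1 else 0 : ℕ) = (!u).toNat := by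
  cases u <;> rfl

namespace Params

variable (g : Params) {W : ℕ} {O : List ℕ → List ℕ}

/-! ### Register conventions -/

/-- The registers after the setup: `X, n, m, g, N, d, N d, L_y, Bv`. [folklore] -/
structure Regs (m : ℕ → ℕ) : Prop where
  r0 : m 0 = g.X
  r2 : m 2 = g.n
  r3 : m 3 = g.m
  r4 : m 4 = g.G
  r5 : m 5 = g.N
  r6 : m 6 = g.d
  r7 : m 7 = g.Nd
  r8 : m 8 = g.Ly
  r10 : m 10 = g.Bv

/-- The environment registers: `Sv, Gv = 0, Pw`. [folklore] -/
structure ERegs (m : ℕ → ℕ) : Prop where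
  r11 : m 11 = g.Sv
  r12 : m 12 = 0
  r13 : m 13 = g.Pw

variable {g}

/-- `Regs` survives changes above register `10`. [folklore] -/
theorem Regs.of_frame {m m' : ℕ → ℕ} (h : g.Regs m) (hf : ∀ a, a ≤ 10 → m' a = m a) : g.Regs m' :=
  ⟨(hf 0 (by omega)).trans h.r0, (hf 2 (by omega)).trans h.r2, (hf 3 (by omega)).trans h.r3,
    (hf 4 (by omega)).trans h.r4, (hf 5 (by omega)).trans h.r5, (hf 6 (by omega)).trans h.r6,
    (hf 7 (by omega)).trans h.r7, (hf 8 (by omega)).trans h.r8, (hf 10 (by omega)).trans h.r10⟩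

/-- `ERegs` survives changes outside `11–13`. [folklore] -/
theorem ERegs.of_frame {m m' : ℕ → ℕ} (h : g.ERegs m) (hf : ∀ a, 11 ≤ a → a ≤ 13 → m' a = m a) :
    g.ERegs m' :=
  ⟨(hf 11 (by omega) (by omega)).trans h.r11, (hf 12 (by omega) (by omega)).trans h.r12,
    (hf 13 (by omega) (by omega)).trans h.r13⟩

variable (g)

/-! ### Reading the relocated input -/

/-- Cell `0` after relocation holds `X`. [folklore] -/
theorem relocated_zero' : relocated g.x 0 = g.X := by
  rw [relocated_zero]; rfl

/-- Cell `1` after relocation holds `X - 1`. [folklore] -/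
theorem relocated_one' : relocated g.x 1 = g.X - 1 := by
  rw [relocated_one]; unfold X Lx; omega

/-- The relocated input: `x[j]` sits in cell `X + j` (and `0` past the input). [folklore] -/
theorem relocated_X_add (j : ℕ) : relocated g.x (g.X + j) = g.x.getD j 0 := by
  by_cases hj : j < g.Lx
  · have := relocated_base_add g.x (i := j + 1) (by omega) (by unfold Lx at hj; omega)
    rw [show g.x.length + 100 + (j + 1) = g.X + j by unfold X Lx; omega] at this
    rw [this]; rfl
  · rw [relocated_of_lt g.x (by unfold X Lx at *; omega),
      List.getD_eq_default _ _ (by unfold Lx at hj; omega)]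

/-- Everything from `Bv` on is `0` after relocation. [folklore] -/
theorem relocated_of_Bv_le {a : ℕ} (ha : g.Bv ≤ a) : relocated g.x a = 0 :=
  relocated_of_lt g.x (by unfold Bv X Lx at ha; omega)

/-- Word `0` of the input is `n = numVars`. [folklore] -/
theorem x_getD_zero : g.x.getD 0 0 = g.n := by
  have := encodeCNFWords_getElem?_zero g.φ
  unfold x n; rw [List.getD_eq_getElem?_getD, this]; rfl

/-- Word `1` of the input is `m`. [folklore] -/
theorem x_getD_one : g.x.getD 1 0 = g.m := by
  have := encodeCNFWords_getElem?_one g.φ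
  unfold x m; rw [List.getD_eq_getElem?_getD, this]; rfl

/-- The relocated cell `X` holds `n`. [folklore] -/
theorem relocated_X : relocated g.x g.X = g.n := by
  have := g.relocated_X_add 0; rw [Nat.add_zero, x_getD_zero] at this; exact this

/-- The relocated cell `X + 1` holds `m`. [folklore] -/
theorem relocated_X_one : relocated g.x (g.X + 1) = g.m := by
  rw [relocated_X_add, x_getD_one]

/-- `numVars` is an input word, hence below `2 ^ W`. [folklore] -/
theorem n_lt (hF : g.Fits W) : g.n < 2 ^ W := by
  have h := hF.input (g.x.getD 0 0) (by
    rw [List.getD_eq_getElem _ _ (by have := g.two_le_Lx; unfold Lx at this; omega)]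
    exact List.getElem_mem _)
  rwa [x_getD_zero] at h

/-- The standard facts about the ghost parameters under `Fits` (linear, except for the defining
products, given as equations). [folklore] -/
theorem facts (hF : g.Fits W) (hk : 1 ≤ g.k) (hc : 1 ≤ g.c) :
    100 < g.X ∧ g.X = g.Lx + 101 ∧ g.X + g.Lx = g.Bv ∧ g.Bv + g.V + 1 = g.Sv ∧
    g.Sv + g.V + 1 ≤ 2 ^ W ∧ g.Ly ≤ g.V ∧ g.Pw ≤ g.V + 1 ∧ g.cM ≤ g.V ∧ g.m + 2 ≤ g.Lx ∧
    2 ≤ g.N ∧ 1 ≤ g.d ∧ g.N ≤ g.Nd ∧ g.d ≤ g.Nd ∧ g.Nd ≤ g.Nd * g.k ∧ g.Nd * g.k + 2 = g.Ly ∧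
    g.N * g.d = g.Nd ∧ 2 ^ g.G = g.N ∧ g.G * g.c = g.d ∧ 1 ≤ g.Pw ∧ 1 ≤ g.G ∧ g.G < g.N ∧
    g.n / g.k + 1 = g.G ∧ 1 ≤ g.k := by
  obtain ⟨h1, h2, h3⟩ := g.bases
  have h4 := hF.top
  obtain ⟨h5, h6, h7⟩ := g.le_V
  have hN := g.two_le_N
  have hd := g.one_le_d hc
  refine ⟨h1, rfl, h2, h3, h4, h5, by omega, h6, g.m_add_two_le_Lx, hN, hd,
    Nat.le_mul_of_pos_right _ hd, Nat.le_mul_of_pos_left _ (by omega),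
    Nat.le_mul_of_pos_right _ hk, rfl, rfl, rfl, by unfold d; ring, Nat.one_le_two_pow,
    Nat.succ_le_succ (Nat.zero_le _), ?_, rfl, hk⟩
  unfold N; exact Nat.lt_two_pow_self

/-! ### The setup phase -/

/-- **Setup, part 1.** From the relocated memory, `setup1` computes the registers `Regs`, leaves
`r1 = X - 1`, `r21 = L_y`, `r22 = 0`, and does not touch the data. [folklore] -/
theorem setup1_spec (hF : g.Fits W) (hk : 1 ≤ g.k) (hc : 1 ≤ g.c) :
    Achieves W O (setup1 g.k g.c) (relocated g.x)
      (fun m => g.Regs m ∧ m 1 = g.X - 1 ∧ m 21 = g.Ly ∧ m 22 = 0 ∧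
        ∀ a, 100 ≤ a → m a = relocated g.x a) 15 := by
  obtain ⟨hX, hXLx, hBv, hSv, htop, hLyV, hPwV, hcMV, hmLx, hN2, hd1, hNNd, hdNd, hNdk, hLy, hNd,
    hNG, hdc, hPw1, hG1, hGN, hGdef, hk1⟩ := g.facts hF hk hc
  have hn := g.n_lt hF
  have hreadn := g.relocated_X
  have hreadm := g.relocated_X_one
  refine achieves_block_of_eq (fun m' hm' => ?_) (by simp)
  simp (disch := first | omega | decide) only [execOps_cons, execOps_nil, execOp,
    Operand.write, Operand.read, merge_apply_of_lt, merge_apply_of_le, update_merge_of_lt,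
    Function.update_self, Function.update_of_ne, BinOp.eval_add_of_lt, BinOp.eval_sub_of_le,
    BinOp.eval_mul_of_lt, BinOp.eval_shl_of_lt, BinOp.eval_div, BinOp.eval_band, Nat.and_self,
    Nat.one_mul, relocated_zero', relocated_one', hreadn, hreadm, hGdef, hNG, hdc, hNd, hLy] at hm'
  subst hm'
  refine ⟨⟨?_, ?_, ?_, ?_, ?_, ?_, ?_, ?_, ?_⟩, ?_, ?_, ?_, fun a ha => ?_⟩
  all_goals (try simp (disch := first | omega | decide) only [merge_apply_of_lt,
    merge_apply_of_le, Function.update_self, Function.update_of_ne])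
  all_goals (try simp only [relocated_zero', relocated_one'])
  all_goals omega

/-- **Setup, part 3.** From the registers of `setup1` and `r22 = size L_y`, `setup3` sets the
environment registers `Sv, Gv = 0, Pw` (`ERegs`), keeping `Regs` and the data. [folklore] -/
theorem setup3_spec (hF : g.Fits W) (hk : 1 ≤ g.k) (hc : 1 ≤ g.c) {m : ℕ → ℕ} (hR : g.Regs m)
    (h22 : m 22 = Nat.size g.Ly) (hD : ∀ a, 100 ≤ a → m a = relocated g.x a) :
    Achieves W O (setup3 g.kM g.cM) m
      (fun m' => g.Regs m' ∧ g.ERegs m' ∧ ∀ a, 100 ≤ a → m' a = relocated g.x a) 15 := by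
  obtain ⟨hX, hXLx, hBv, hSv, htop, hLyV, hPwV, hcMV, hmLx, hN2, hd1, hNNd, hdNd, hNdk, hLy, hNd,
    hNG, hdc, hPw1, hG1, hGN, hGdef, hk1⟩ := g.facts hF hk hc
  have hwsW : g.ws < W := hF.ws_lt
  have hW : W < 2 ^ W := Nat.lt_two_pow_self
  have hws : Nat.size g.Ly * g.kM = g.ws := Nat.mul_comm _ _
  have hPw : 2 ^ g.ws = g.Pw := rfl
  have hPwW : g.Pw < 2 ^ W := Nat.pow_lt_pow_right (by norm_num) hwsW
  obtain ⟨r0, r2, r3, r4, r5, r6, r7, r8, r10⟩ := hR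
  unfold setup3
  -- block 1
  refine Achieves.seqs_cons (R := fun m₁ => m₁ 13 = g.Pw ∧ m₁ 23 = g.Pw - 1 ∧
      m₁ 24 = (if g.Pw - 1 < g.cM then 1 else 0) ∧ ∀ a, a ≠ 13 → a ≠ 22 → a ≠ 23 → a ≠ 24 →
        m₁ a = m a) (T₁ := 4) (T₂ := 11) ?_ ?_
  · refine achieves_block_of_eq (fun m' hm' => ?_) le_rfl
    simp (disch := first | omega | decide) only [execOps_cons, execOps_nil, execOp, Operand.write,
      Operand.read, merge_apply_of_lt, update_merge_of_lt, Function.update_self,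
      BinOp.eval_sub_of_le, BinOp.eval_mul_of_lt, BinOp.eval_shl_of_lt, BinOp.eval_lt,
      Nat.one_mul, h22, hws, hPw] at hm'
    subst hm'
    refine ⟨?_, ?_, ?_, fun a h1 h2 h3 h4 => ?_⟩
    · (try simp (disch := first | omega | decide) only [merge_apply_of_lt, Function.update_self,
      Function.update_of_ne])
    · (try simp (disch := first | omega | decide) only [merge_apply_of_lt, Function.update_self,
      Function.update_of_ne])
    · (try simp (disch := first | omega | decide) only [merge_apply_of_lt, Function.update_self])
    · by_cases ha : a < 100
      · rw [merge_apply_of_lt ha]; simp [Function.update_of_ne, h1, h2, h3, h4]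
      · rw [merge_apply_of_le (by omega)]
  rintro m₁ ⟨q13, q23, q24, qf⟩
  -- ifz 1
  refine Achieves.seqs_cons (R := fun m₂ => m₂ 23 = max (g.Pw - 1) g.cM ∧
      ∀ a, a ≠ 22 → a ≠ 23 → a ≠ 24 → m₂ a = m₁ a) (T₁ := 3) (T₂ := 8) ?_ ?_
  · refine Achieves.ifz (fun h0 => Achieves.skip ⟨?_, fun a _ _ _ => rfl⟩) (fun h1 => ?_)
    · simp only [Operand.read, q24] at h0
      have hc' : ¬ g.Pw - 1 < g.cM := fun hc' => by simp [hc'] at h0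
      rw [q23, max_eq_left (not_lt.1 hc')]
    · simp only [Operand.read, q24] at h1
      have hlt : g.Pw - 1 < g.cM := by by_contra hc'; simp [hc'] at h1
      refine achieves_block_of_eq (fun m' hm' => ?_) le_rfl
      simp (disch := first | omega | decide) only [execOps_cons, execOps_nil, execOp,
        Operand.write, Operand.read, update_merge_of_lt, BinOp.eval_band, Nat.and_self] at hm'
      subst hm'
      refine ⟨?_, fun a _ h23 _ => ?_⟩
      · (try simp (disch := first | omega | decide) only [merge_apply_of_lt,
        Function.update_self]); rw [max_eq_right hlt.le]
      · by_cases ha : a < 100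
        · rw [merge_apply_of_lt ha, Function.update_of_ne h23]
        · rw [merge_apply_of_le (by omega)]
  rintro m₂ ⟨p23, pf⟩
  have p8 : m₂ 8 = g.Ly := by
    rw [pf 8 (by omega) (by omega) (by omega), qf 8 (by omega) (by omega) (by omega) (by omega), r8]
  have hmaxV : max (g.Pw - 1) g.cM ≤ g.V := max_le (by omega) hcMV
  -- block 2
  refine Achieves.seqs_cons (R := fun m₃ => m₃ 23 = max (g.Pw - 1) g.cM ∧
      m₃ 25 = g.Ly ∧ m₃ 24 = (if max (g.Pw - 1) g.cM < g.Ly then 1 else 0) ∧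
      ∀ a, a ≠ 22 → a ≠ 23 → a ≠ 24 → a ≠ 25 → m₃ a = m₁ a) (T₁ := 2) (T₂ := 6) ?_ ?_
  · refine achieves_block_of_eq (fun m' hm' => ?_) le_rfl
    simp (disch := first | omega | decide) only [execOps_cons, execOps_nil, execOp, Operand.write,
      Operand.read, merge_apply_of_lt, update_merge_of_lt, Function.update_self,
      Function.update_of_ne, BinOp.eval_band, BinOp.eval_lt, Nat.and_self, p23, p8] at hm'
    subst hm'
    refine ⟨?_, ?_, ?_, fun a h1 h2 h3 h4 => ?_⟩
    · (try simp (disch := first | omega | decide) only [merge_apply_of_lt,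
      Function.update_of_ne]); exact p23
    · (try simp (disch := first | omega | decide) only [merge_apply_of_lt, Function.update_self,
      Function.update_of_ne])
    · (try simp (disch := first | omega | decide) only [merge_apply_of_lt, Function.update_self])
    · by_cases ha : a < 100
      · rw [merge_apply_of_lt ha]; simp [Function.update_of_ne, h3, h4, pf a h1 h2 h3]
      · rw [merge_apply_of_le (by omega), pf a h1 h2 h3]
  rintro m₃ ⟨s23, s25, s24, sf⟩
  -- ifz 2
  refine Achieves.seqs_cons (R := fun m₄ => m₄ 23 = g.V ∧
      ∀ a, a ≠ 22 → a ≠ 23 → a ≠ 24 → a ≠ 25 → m₄ a = m₁ a) (T₁ := 3) (T₂ := 3) ?_ ?_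
  · refine Achieves.ifz (fun h0 => Achieves.skip ⟨?_, sf⟩) (fun h1 => ?_)
    · simp only [Operand.read, s24] at h0
      have hc' : ¬ max (g.Pw - 1) g.cM < g.Ly := fun hc' => by simp [hc'] at h0
      rw [s23]; show _ = max (g.Pw - 1) (max g.cM g.Ly)
      rw [← max_assoc, max_eq_left (not_lt.1 hc')]
    · simp only [Operand.read, s24] at h1
      have hlt : max (g.Pw - 1) g.cM < g.Ly := by by_contra hc'; simp [hc'] at h1
      refine achieves_block_of_eq (fun m' hm' => ?_) le_rfl
      simp (disch := first | omega | decide) only [execOps_cons, execOps_nil, execOp,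
        Operand.write, Operand.read, merge_apply_of_lt, update_merge_of_lt, BinOp.eval_band,
        Nat.and_self, s25] at hm'
      subst hm'
      refine ⟨?_, fun a h22 h23 h24 h25 => ?_⟩
      · (try simp (disch := first | omega | decide) only [merge_apply_of_lt,
        Function.update_self]); show _ = max (g.Pw - 1) (max g.cM g.Ly)
        rw [← max_assoc, max_eq_right hlt.le]
      · by_cases ha : a < 100
        · rw [merge_apply_of_lt ha, Function.update_of_ne h23, sf a h22 h23 h24 h25]
        · rw [merge_apply_of_le (by omega), sf a h22 h23 h24 h25]
  rintro m₄ ⟨t23, tf⟩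
  have back : ∀ a, a ≠ 13 → a ≠ 22 → a ≠ 23 → a ≠ 24 → a ≠ 25 → m₄ a = m a :=
    fun a h1 h2 h3 h4 h5 => by rw [tf a h2 h3 h4 h5, qf a h1 h2 h3 h4]
  have t10 : m₄ 10 = g.Bv := by
    rw [back 10 (by omega) (by omega) (by omega) (by omega) (by omega), r10]
  -- block 3
  refine Achieves.seqs_cons (T₁ := 3) (T₂ := 0) ?_ (fun _ h => Achieves.seqs_nil h)
  refine achieves_block_of_eq (fun m' hm' => ?_) le_rfl
  simp (disch := first | omega | decide) only [execOps_cons, execOps_nil, execOp, Operand.write,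
    Operand.read, merge_apply_of_lt, update_merge_of_lt, Function.update_self,
    BinOp.eval_add_of_lt, BinOp.eval_band, Nat.and_self, t23, t10] at hm'
  subst hm'
  refine ⟨⟨?_, ?_, ?_, ?_, ?_, ?_, ?_, ?_, ?_⟩, ⟨?_, ?_, ?_⟩, fun a ha => ?_⟩
  all_goals (try simp (disch := first | omega | decide) only [merge_apply_of_lt,
    merge_apply_of_le, Function.update_self, Function.update_of_ne])
  · rw [back 0 (by omega) (by omega) (by omega) (by omega) (by omega), r0]
  · rw [back 2 (by omega) (by omega) (by omega) (by omega) (by omega), r2]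
  · rw [back 3 (by omega) (by omega) (by omega) (by omega) (by omega), r3]
  · rw [back 4 (by omega) (by omega) (by omega) (by omega) (by omega), r4]
  · rw [back 5 (by omega) (by omega) (by omega) (by omega) (by omega), r5]
  · rw [back 6 (by omega) (by omega) (by omega) (by omega) (by omega), r6]
  · rw [back 7 (by omega) (by omega) (by omega) (by omega) (by omega), r7]
  · rw [back 8 (by omega) (by omega) (by omega) (by omega) (by omega), r8]
  · exact t10
  · omega
  · rw [tf 13 (by omega) (by omega) (by omega) (by omega), q13]
  · rw [back a (by omega) (by omega) (by omega) (by omega) (by omega), hD a ha]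

end Params

end KOVRed

end Literature.Computability.FineGrained

namespace Literature.Computability.FineGrained

open Cryptography Cryptography.WordRAM Complexity Cryptography.WordRAM.SProg
open CliqueRed (r pt im lay achieves_block_of_eq ite_and_ite ite_eq_toNat_decide toNat_and_toNat
  shiftRight_and_one litCode_shiftRight_one litCode_and_one)

namespace KOVRed

namespace Params

variable (g : Params) {W : ℕ} {O : List ℕ → List ℕ}

/-! ### Clauses and literals by position; the literal test -/

/-- Clause `j` of the formula (empty past the end). [folklore] -/
def clause (j : ℕ) : Clause ℕ := g.φ.getD j []

/-- The literal test of the reduction: the literal's variable lies in group `l` and receives its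
polarity from the assignment `a` of that group. [folklore] -/
def litTest (l a : ℕ) (lit : Literal ℕ) : Bool :=
  decide (lit.1 / g.G = l) && (a.testBit (lit.1 % g.G) == lit.2)

/-- The flag after `t` literals of clause `j`: some of the first `t` literals passes the test.
[folklore] -/
def satAny (l a j t : ℕ) : Bool := ((g.clause j).take t).any (g.litTest l a)

/-- An existing clause. [folklore] -/
theorem clause_eq {j : ℕ} (hj : j < g.m) : g.clause j = g.φ[j]'hj := List.getD_eq_getElem _ _ hj

/-- No literal tested yet. [folklore] -/
theorem satAny_zero (l a j : ℕ) : g.satAny l a j 0 = false := by simp [satAny]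

/-- One more literal tested. [folklore] -/
theorem satAny_succ (l a : ℕ) {j : ℕ} (hj : j < g.m) {t : ℕ} (ht : t < (g.φ[j]'hj).length) :
    g.satAny l a j (t + 1) = (g.satAny l a j t || g.litTest l a ((g.φ[j]'hj)[t]'ht)) := by
  unfold satAny
  rw [g.clause_eq hj, List.take_add_one, List.getElem?_eq_getElem ht, Option.toList_some,
    List.any_append, List.any_cons, List.any_nil, Bool.or_false]

/-- All literals tested: the flag is `satB`. [folklore] -/
theorem satAny_length (l a : ℕ) {j : ℕ} (hj : j < g.m) :
    g.satAny l a j (g.clause j).length = satB g.φ g.G l a j := by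
  unfold satAny satB
  rw [List.take_length, List.getElem?_eq_getElem hj, clause_eq g hj]
  rfl

/-- **The cell bit**: "no literal passes the test" is the vector bit `vecB`. [folklore] -/
theorem cell_eq (l a : ℕ) {j : ℕ} (hj : j < g.m) :
    (!g.satAny l a j (g.clause j).length).toNat = (vecB g.φ g.G l a j).toNat := by
  rw [satAny_length g l a hj, vecB_of_lt _ _ hj]

/-- The literal test as computed by `litBody` with `eq`/`band`. [folklore] -/
theorem litTest_toNat (l a : ℕ) (lit : Literal ℕ) :
    ((if lit.1 / g.G = l then 1 else 0 : ℕ) &&&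
      (if (a.testBit (lit.1 % g.G)).toNat = lit.2.toNat then 1 else 0)) = (g.litTest l a lit).toNat := by
  rw [ite_toNat_eq_toNat, ite_eq_toNat_decide, toNat_and_toNat]; rfl

/-- The length word of clause `j` in the input. [folklore] -/
theorem x_getD_clauseStart {j : ℕ} (hj : j < g.m) :
    g.x.getD (clauseStart g.φ j) 0 = (g.φ[j]'hj).length := by
  have := encodeCNFWords_getElem?_clauseStart g.φ hj
  unfold x; rw [List.getD_eq_getElem?_getD, this]; rfl

/-- The literal words of clause `j` in the input. [folklore] -/
theorem x_getD_lit {j : ℕ} (hj : j < g.m) {t : ℕ} (ht : t < (g.φ[j]'hj).length) :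
    g.x.getD (clauseStart g.φ j + 1 + t) 0 = litCode ((g.φ[j]'hj)[t]'ht) := by
  have := encodeCNFWords_getElem?_clauseStart_succ g.φ hj ht
  unfold x; rw [List.getD_eq_getElem?_getD, this]; rfl

/-- Clause blocks lie inside the input. [folklore] -/
theorem clauseStart_le {j : ℕ} (hj : j < g.m) :
    clauseStart g.φ j + 1 + (g.φ[j]'hj).length ≤ g.Lx := by
  have := clauseStart_add_length_le g.φ hj; unfold Lx x; exact this

/-- `clauseStart` at `m` is at most `Lx`. [folklore] -/
theorem clauseStart_m_le : clauseStart g.φ g.m ≤ g.Lx := by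
  unfold Lx x m; rw [length_encodeCNFWords]

/-! ### Reading and stepping the table data -/

/-- Below `Bv + 3` every stage of the data is the relocated input. [folklore] -/
theorem fillData_of_lt (ρ j : ℕ) {a : ℕ} (ha : a < g.Bv + 3) : g.fillData ρ j a = relocated g.x a := by
  unfold fillData; rw [if_pos ha]

/-- The input words at every stage. [folklore] -/
theorem fillData_X_add (ρ j : ℕ) {i : ℕ} (hi : i < g.Lx) : g.fillData ρ j (g.X + i) = g.x.getD i 0 := by
  rw [fillData_of_lt _ _ _ (by have := g.bases; omega), relocated_X_add]

/-- Stage `(0, 0)` is the relocated memory. [folklore] -/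
theorem fillData_zero_zero (a : ℕ) : g.fillData 0 0 a = relocated g.x a := by
  unfold fillData
  by_cases ha : a < g.Bv + 3
  · rw [if_pos ha]
  · rw [if_neg ha, g.relocated_of_Bv_le (by omega)]; simp

/-- **The value of table cell `(l N + a) d + j`** is the reduced bit `vecB l a j`. [folklore] -/
theorem cellVal_eq {l a j : ℕ} (ha : a < g.N) (hj : j < g.d) :
    g.cellVal ((l * g.N + a) * g.d + j) = (vecB g.φ g.G l a j).toNat % g.Pw := by
  have hd : 0 < g.d := by omega
  have hN : 0 < g.N := by omega
  unfold cellVal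
  rw [Nat.mul_comm (l * g.N + a) g.d, Nat.mul_add_div hd, Nat.div_eq_of_lt hj, Nat.add_zero,
    Nat.mul_add_mod, Nat.mod_eq_of_lt hj, Nat.mul_comm l g.N, Nat.mul_add_div hN,
    Nat.div_eq_of_lt ha, Nat.add_zero, Nat.mul_add_mod, Nat.mod_eq_of_lt ha]

/-- **One cell written**: writing `cellVal (ρ d + j)` at `Bv + 3 + ρ d + j` turns stage `(ρ, j)`
into stage `(ρ, j + 1)`. [folklore] -/
theorem fillData_succ {ρ j : ℕ} {m : ℕ → ℕ}
    (hm : ∀ a, 100 ≤ a → m a = g.fillData ρ j a) (a : ℕ) (ha : 100 ≤ a) :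
    Function.update m (g.Bv + 3 + ρ * g.d + j) (g.cellVal (ρ * g.d + j)) a =
      g.fillData ρ (j + 1) a := by
  by_cases h1 : a = g.Bv + 3 + ρ * g.d + j
  · subst h1; rw [Function.update_self]; unfold fillData
    rw [if_neg (by omega), if_pos (by omega), show g.Bv + 3 + ρ * g.d + j - (g.Bv + 3) =
      ρ * g.d + j by omega]
  rw [Function.update_of_ne h1, hm a ha]
  unfold fillData
  by_cases h3 : a < g.Bv + 3
  · rw [if_pos h3, if_pos h3]
  rw [if_neg h3, if_neg h3]
  have : (a - (g.Bv + 3) < ρ * g.d + j) ↔ (a - (g.Bv + 3) < ρ * g.d + (j + 1)) := by omega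
  simp only [this]

/-- **Next row**: the padding cells `j ≥ m` of row `ρ` are `0` anyway, so stage `(ρ, m)` is stage
`(ρ + 1, 0)` (for `m ≤ d`). [folklore] -/
theorem fillData_row (ρ : ℕ) (hmd : g.m ≤ g.d) (a : ℕ) : g.fillData ρ g.m a = g.fillData (ρ + 1) 0 a := by
  unfold fillData
  by_cases h3 : a < g.Bv + 3
  · rw [if_pos h3, if_pos h3]
  rw [if_neg h3, if_neg h3]
  simp only [Nat.add_zero]
  set q := a - (g.Bv + 3)
  have hsucc : (ρ + 1) * g.d = ρ * g.d + g.d := add_one_mul ρ g.d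
  by_cases h4 : q < ρ * g.d + g.m
  · rw [if_pos h4, if_pos (by omega)]
  rw [if_neg h4]
  by_cases h5 : q < (ρ + 1) * g.d
  · rw [if_pos h5]
    have hq : q / g.d = ρ := Nat.div_eq_of_lt_le (by omega) h5
    have hr : g.m ≤ q % g.d := by
      have h6 := Nat.div_add_mod q g.d
      rw [hq] at h6
      have h7 : g.d * ρ = ρ * g.d := Nat.mul_comm _ _
      omega
    unfold cellVal
    rw [vecB_of_le _ _ hr]; simp
  · rw [if_neg h5]

/-! ### Time bounds of the loops -/

/-- The cost of one clause of width `≤ kw`. [folklore] -/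
def Tcl (kw : ℕ) : ℕ := kw * 18 + 12
/-- The cost of one row. [folklore] -/
def Trow (kw : ℕ) : ℕ := g.m * (Tcl kw + 2) + 11
/-- The cost of one list. [folklore] -/
def Tlist (kw : ℕ) : ℕ := g.N * (g.Trow kw + 2) + 5
/-- The cost of the tables. [folklore] -/
def Tfill (kw : ℕ) : ℕ := g.k * (g.Tlist kw + 2) + 3


/-! ### The literal loop -/

/-- The invariant of the literal loop of clause `j` of row `(l, a)` after `t` literals. [folklore] -/
structure LitInv (l a j Lq t : ℕ) (m : ℕ → ℕ) : Prop where
  regs : g.Regs m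
  eregs : g.ERegs m
  r30 : m 30 = l
  r31 : m 31 = g.k - l
  r32 : m 32 = a
  r33 : m 33 = g.N - a
  r34 : m 34 = g.X + clauseStart g.φ j
  r35 : m 35 = j
  r36 : m 36 = g.m - j
  r37 : m 37 = Lq
  r38 : m 38 = (g.satAny l a j t).toNat
  r39 : m 39 = g.X + (clauseStart g.φ j + 1 + t)
  r40 : m 40 = Lq - t
  r50 : m 50 = g.Bv + 3 + (l * g.N + a) * g.d
  data : ∀ c, 100 ≤ c → m c = g.fillData (l * g.N + a) j c

/-- **One literal.** [folklore] -/
theorem litBody_spec (hF : g.Fits W) (hk : 1 ≤ g.k) (hc : 1 ≤ g.c) {l a j : ℕ} (hj : j < g.m)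
    {t : ℕ} (ht : t < (g.φ[j]'hj).length) {m : ℕ → ℕ} (hI : g.LitInv l a j (g.φ[j]'hj).length t m) :
    Achieves W O litBody m (g.LitInv l a j (g.φ[j]'hj).length (t + 1)) 16 := by
  obtain ⟨hX, hXLx, hBv, hSv, htop, hLyV, hPwV, hcMV, hmLx, hN2, hd1, hNNd, hdNd, hNdk, hLy, hNd,
    hNG, hdc, hPw1, hG1, hGN, hGdef, hk1⟩ := g.facts hF hk hc
  set Lq := (g.φ[j]'hj).length with hLq
  have hcs : clauseStart g.φ j + 1 + Lq ≤ g.Lx := g.clauseStart_le hj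
  obtain ⟨⟨r0, r2, r3, r4, r5, r6, r7, r8, r10⟩, ⟨r11, r12, r13⟩, r30, r31, r32, r33, r34, r35,
    r36, r37, r38, r39, r40, r50, hD⟩ := hI
  -- the literal read
  have hread : m (g.X + (clauseStart g.φ j + 1 + t)) = litCode ((g.φ[j]'hj)[t]'ht) := by
    rw [hD _ (by omega), g.fillData_X_add _ _ (by omega), g.x_getD_lit hj ht]
  have hstep : (g.satAny l a j t || g.litTest l a ((g.φ[j]'hj)[t]'ht)) = g.satAny l a j (t + 1) :=
    (g.satAny_succ l a hj ht).symm
  refine achieves_block_of_eq (fun m'' hm'' => ?_) le_rfl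
  simp (disch := first | omega | decide) only [execOps_cons, execOps_nil, execOp, Operand.write,
    Operand.read, merge_apply_of_lt, merge_apply_of_le, update_merge_of_lt,
    Function.update_self, Function.update_of_ne, BinOp.eval_add_of_lt, BinOp.eval_sub_of_le,
    BinOp.eval_band, BinOp.eval_shr, BinOp.eval_div, BinOp.eval_mod, BinOp.eval_eq,
    BinOp.eval_lt, Nat.and_self, r4, r30, r32, r38, r39, r40, hread, litCode_shiftRight_one,
    litCode_and_one, shiftRight_and_one] at hm''
  subst hm''
  refine ⟨⟨?_, ?_, ?_, ?_, ?_, ?_, ?_, ?_, ?_⟩, ⟨?_, ?_, ?_⟩, ?_, ?_, ?_, ?_, ?_, ?_, ?_, ?_,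
    ?flag, ?_, ?_, ?_, fun c hc' => ?data⟩
  case data =>
    (try simp (disch := first | omega | decide) only [merge_apply_of_le])
    exact hD c hc'
  case flag =>
    (try simp (disch := first | omega | decide) only [merge_apply_of_lt, Function.update_self,
      Function.update_of_ne])
    rw [litTest_toNat, CliqueRed.or_toNat, Bool.or_comm, hstep]
  all_goals (try simp (disch := first | omega | decide) only [merge_apply_of_lt,
    Function.update_self, Function.update_of_ne])
  all_goals first | assumption | omega

/-- **The literal loop of clause `j`.** [folklore] -/
theorem litBody_loop (hF : g.Fits W) (hk : 1 ≤ g.k) (hc : 1 ≤ g.c) {l a j : ℕ} (hj : j < g.m)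
    {m : ℕ → ℕ} (h0 : g.LitInv l a j (g.φ[j]'hj).length 0 m) :
    Achieves W O (whilenz (r 40) litBody) m (g.LitInv l a j (g.φ[j]'hj).length (g.φ[j]'hj).length)
      ((g.φ[j]'hj).length * 18 + 1) := by
  refine Achieves.whilenz (g.φ[j]'hj).length 16 (fun t => g.LitInv l a j (g.φ[j]'hj).length t)
    (fun t ht m' hI => ⟨?_, g.litBody_spec hF hk hc hj ht hI⟩) (fun m' hI => ?_) h0 (fun _ h => h)
    (by omega)
  · simp only [Operand.read, hI.r40]; omega
  · simp only [Operand.read, hI.r40]; omega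

/-! ### The clause loop -/

/-- The invariant of the clause loop of row `(l, a)` after `j` clauses. [folklore] -/
structure ClauseInv (l a j : ℕ) (m : ℕ → ℕ) : Prop where
  regs : g.Regs m
  eregs : g.ERegs m
  r30 : m 30 = l
  r31 : m 31 = g.k - l
  r32 : m 32 = a
  r33 : m 33 = g.N - a
  r34 : m 34 = g.X + clauseStart g.φ j
  r35 : m 35 = j
  r36 : m 36 = g.m - j
  r50 : m 50 = g.Bv + 3 + (l * g.N + a) * g.d
  data : ∀ c, 100 ≤ c → m c = g.fillData (l * g.N + a) j c

/-- One clause, the opening block: read the length, reset the flag and the literal pointer.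
[folklore] -/
theorem clauseBody_init (hF : g.Fits W) (hk : 1 ≤ g.k) (hc : 1 ≤ g.c) {l a j : ℕ} (hj : j < g.m)
    {m : ℕ → ℕ} (h0 : g.ClauseInv l a j m) :
    Achieves W O (block [(.band, r 37, pt 34, pt 34), (.band, r 38, im 0, im 0),
      (.add, r 39, r 34, im 1), (.band, r 40, r 37, r 37)]) m (g.LitInv l a j (g.φ[j]'hj).length 0)
      4 := by
  obtain ⟨hX, hXLx, hBv, hSv, htop, hLyV, hPwV, hcMV, hmLx, hN2, hd1, hNNd, hdNd, hNdk, hLy, hNd,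
    hNG, hdc, hPw1, hG1, hGN, hGdef, hk1⟩ := g.facts hF hk hc
  obtain ⟨⟨r0, r2, r3, r4, r5, r6, r7, r8, r10⟩, ⟨r11, r12, r13⟩, r30, r31, r32, r33, r34, r35,
    r36, r50, hD⟩ := h0
  set Lq := (g.φ[j]'hj).length with hLq
  have hcs : clauseStart g.φ j + 1 + Lq ≤ g.Lx := g.clauseStart_le hj
  have hread : m (g.X + clauseStart g.φ j) = Lq := by
    rw [hD _ (by omega), g.fillData_X_add _ _ (by omega), g.x_getD_clauseStart hj]
  refine achieves_block_of_eq (fun m' hm' => ?_) le_rfl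
  simp (disch := first | omega | decide) only [execOps_cons, execOps_nil, execOp, Operand.write,
    Operand.read, merge_apply_of_lt, merge_apply_of_le, update_merge_of_lt,
    Function.update_self, Function.update_of_ne, BinOp.eval_add_of_lt, BinOp.eval_band,
    Nat.and_self, r34, hread] at hm'
  subst hm'
  refine ⟨⟨?_, ?_, ?_, ?_, ?_, ?_, ?_, ?_, ?_⟩, ⟨?_, ?_, ?_⟩, ?_, ?_, ?_, ?_, ?_, ?_, ?_, ?_,
    ?flag, ?_, ?_, ?_, fun c hc' => ?data⟩
  case data => (try simp (disch := first | omega | decide) only [merge_apply_of_le]); exact hD c hc'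
  case flag =>
    (try simp (disch := first | omega | decide) only [merge_apply_of_lt, Function.update_self,
      Function.update_of_ne])
    rw [satAny_zero]; rfl
  all_goals (try simp (disch := first | omega | decide) only [merge_apply_of_lt,
    Function.update_self, Function.update_of_ne])
  all_goals first | assumption | omega

/-- One clause, the closing block: write the cell, advance the clause pointer and the counters.
[folklore] -/
theorem clauseBody_finish (hF : g.Fits W) (hk : 1 ≤ g.k) (hc : 1 ≤ g.c) (hmd : g.m ≤ g.d)
    {l a j : ℕ} (hl : l < g.k) (ha : a < g.N) (hj : j < g.m) {m : ℕ → ℕ}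
    (h₂ : g.LitInv l a j (g.φ[j]'hj).length (g.φ[j]'hj).length m) :
    Achieves W O (block [(.eq, r 48, r 38, im 0), (.mod, r 48, r 48, r 13), (.add, r 49, r 50, r 35),
      (.band, pt 49, r 48, r 48), (.band, r 34, r 39, r 39), (.add, r 35, r 35, im 1),
      (.sub, r 36, r 36, im 1)]) m (g.ClauseInv l a (j + 1)) 7 := by
  obtain ⟨hX, hXLx, hBv, hSv, htop, hLyV, hPwV, hcMV, hmLx, hN2, hd1, hNNd, hdNd, hNdk, hLy, hNd,
    hNG, hdc, hPw1, hG1, hGN, hGdef, hk1⟩ := g.facts hF hk hc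
  obtain ⟨hR₂, hE₂, s30, s31, s32, s33, s34, s35, s36, s37, s38, s39, s40, s50, sD⟩ := h₂
  set Lq := (g.φ[j]'hj).length with hLq
  have hcs : clauseStart g.φ j + 1 + Lq ≤ g.Lx := g.clauseStart_le hj
  have hrow : l * g.N + a < g.k * g.N := g.row_lt hl ha
  have hcells : (l * g.N + a) * g.d + g.d ≤ g.Nd * g.k := g.row_cells_le hrow
  have s13 : m 13 = g.Pw := hE₂.r13
  refine achieves_block_of_eq (fun m' hm' => ?_) le_rfl
  simp (disch := first | omega | decide) only [execOps_cons, execOps_nil, execOp, Operand.write,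
    Operand.read, merge_apply_of_lt, update_merge_of_lt, update_merge_of_le,
    Function.update_self, Function.update_of_ne, BinOp.eval_add_of_lt, BinOp.eval_sub_of_le,
    BinOp.eval_mod, BinOp.eval_band, BinOp.eval_eq, Nat.and_self, s13, s35, s36, s38, s39,
    s50] at hm'
  subst hm'
  have hcl : (g.clause j).length = Lq := by rw [g.clause_eq hj]
  have hval : (if (g.satAny l a j Lq).toNat = 0 then 1 else 0 : ℕ) % g.Pw =
      g.cellVal ((l * g.N + a) * g.d + j) := by
    rw [g.cellVal_eq ha (by omega), ite_toNat_eq_zero, ← hcl, g.cell_eq l a hj]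
  have hcs' := clauseStart_succ g.φ hj
  refine ⟨hR₂.of_frame fun c hc' => ?_, hE₂.of_frame fun c hc' hc'' => ?_, ?_, ?_, ?_, ?_, ?_, ?_,
    ?_, ?_, fun c hc' => ?data⟩
  case data =>
    (try simp (disch := first | omega | decide) only [merge_apply_of_le])
    rw [hval]
    exact g.fillData_succ sD c hc'
  · rw [merge_apply_of_lt (by omega)]; simp (disch := omega) only [Function.update_of_ne]
  · rw [merge_apply_of_lt (by omega)]; simp (disch := omega) only [Function.update_of_ne]
  all_goals (try simp (disch := first | omega | decide) only [merge_apply_of_lt,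
    Function.update_self, Function.update_of_ne])
  all_goals first | assumption | omega

/-- **One clause.** [folklore] -/
theorem clauseBody_spec (hF : g.Fits W) (hk : 1 ≤ g.k) (hc : 1 ≤ g.c) {kw : ℕ}
    (hw : g.φ.IsWidthLE kw) (hmd : g.m ≤ g.d) {l a j : ℕ} (hl : l < g.k) (ha : a < g.N)
    (hj : j < g.m) {m : ℕ → ℕ} (h0 : g.ClauseInv l a j m) :
    Achieves W O clauseBody m (g.ClauseInv l a (j + 1)) (Tcl kw) := by
  have hLqw : (g.φ[j]'hj).length ≤ kw := hw _ (List.getElem_mem hj)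
  unfold clauseBody Tcl
  refine Achieves.mono (T := 4 + (((g.φ[j]'hj).length * 18 + 1) + (7 + 0))) ?_ (fun _ h => h)
    (by omega)
  exact Achieves.seqs_cons (g.clauseBody_init hF hk hc hj h0) fun m₁ h₁ =>
    Achieves.seqs_cons (g.litBody_loop hF hk hc hj h₁) fun m₂ h₂ =>
      Achieves.seqs_cons (g.clauseBody_finish hF hk hc hmd hl ha hj h₂) fun _ h =>
        Achieves.seqs_nil h

/-! ### The row loop -/

/-- The invariant of the row loop of list `l` after `a` rows. [folklore] -/
structure RowInv (l a : ℕ) (m : ℕ → ℕ) : Prop where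
  regs : g.Regs m
  eregs : g.ERegs m
  r30 : m 30 = l
  r31 : m 31 = g.k - l
  r32 : m 32 = a
  r33 : m 33 = g.N - a
  data : ∀ c, 100 ≤ c → m c = g.fillData (l * g.N + a) 0 c

/-- One row, the opening block: reset the clause pointer and counters, compute the row base.
[folklore] -/
theorem rowBody_init (hF : g.Fits W) (hk : 1 ≤ g.k) (hc : 1 ≤ g.c) {l a : ℕ} (hl : l < g.k)
    (ha : a < g.N) {m : ℕ → ℕ} (hI : g.RowInv l a m) :
    Achieves W O (block [(.add, r 34, r 0, im 2), (.band, r 35, im 0, im 0), (.band, r 36, r 3, r 3),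
      (.mul, r 50, r 30, r 5), (.add, r 50, r 50, r 32), (.mul, r 50, r 50, r 6),
      (.add, r 50, r 50, im 3), (.add, r 50, r 50, r 10)]) m (g.ClauseInv l a 0) 8 := by
  obtain ⟨hX, hXLx, hBv, hSv, htop, hLyV, hPwV, hcMV, hmLx, hN2, hd1, hNNd, hdNd, hNdk, hLy, hNd,
    hNG, hdc, hPw1, hG1, hGN, hGdef, hk1⟩ := g.facts hF hk hc
  obtain ⟨⟨r0, r2, r3, r4, r5, r6, r7, r8, r10⟩, ⟨r11, r12, r13⟩, r30, r31, r32, r33, hD⟩ := hI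
  have hrow : l * g.N + a < g.k * g.N := g.row_lt hl ha
  have hkN : g.k * g.N ≤ g.Nd * g.k := by rw [Nat.mul_comm]; exact Nat.mul_le_mul_right _ hNNd
  have hcells : (l * g.N + a) * g.d + g.d ≤ g.Nd * g.k := g.row_cells_le hrow
  have hlN : l * g.N ≤ l * g.N + a := Nat.le_add_right _ _
  have hcs0 := clauseStart_zero g.φ
  refine achieves_block_of_eq (fun m' hm' => ?_) le_rfl
  simp (disch := first | omega | decide) only [execOps_cons, execOps_nil, execOp, Operand.write,
    Operand.read, merge_apply_of_lt, update_merge_of_lt, Function.update_self,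
    Function.update_of_ne, BinOp.eval_add_of_lt, BinOp.eval_mul_of_lt, BinOp.eval_band,
    Nat.and_self, r0, r3, r5, r6, r10, r30, r32] at hm'
  subst hm'
  refine ⟨⟨?_, ?_, ?_, ?_, ?_, ?_, ?_, ?_, ?_⟩, ⟨?_, ?_, ?_⟩, ?_, ?_, ?_, ?_, ?_, ?_, ?_, ?_,
    fun c hc' => ?data⟩
  case data => (try simp (disch := first | omega | decide) only [merge_apply_of_le]); exact hD c hc'
  all_goals (try simp (disch := first | omega | decide) only [merge_apply_of_lt,
    Function.update_self, Function.update_of_ne])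
  all_goals first | assumption | omega

/-- One row, the closing block: advance `a`; the padding cells make the next row's stage.
[folklore] -/
theorem rowBody_finish (hF : g.Fits W) (hk : 1 ≤ g.k) (hc : 1 ≤ g.c) (hmd : g.m ≤ g.d) {l a : ℕ}
    (ha : a < g.N) {m : ℕ → ℕ} (h₂ : g.ClauseInv l a g.m m) :
    Achieves W O (block [(.add, r 32, r 32, im 1), (.sub, r 33, r 33, im 1)]) m
      (g.RowInv l (a + 1)) 2 := by
  obtain ⟨hX, hXLx, hBv, hSv, htop, hLyV, hPwV, hcMV, hmLx, hN2, hd1, hNNd, hdNd, hNdk, hLy, hNd,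
    hNG, hdc, hPw1, hG1, hGN, hGdef, hk1⟩ := g.facts hF hk hc
  obtain ⟨hR₂, hE₂, s30, s31, s32, s33, -, -, -, -, sD⟩ := h₂
  refine achieves_block_of_eq (fun m' hm' => ?_) le_rfl
  simp (disch := first | omega | decide) only [execOps_cons, execOps_nil, execOp, Operand.write,
    Operand.read, merge_apply_of_lt, update_merge_of_lt, Function.update_of_ne,
    BinOp.eval_add_of_lt, BinOp.eval_sub_of_le, s32, s33] at hm'
  subst hm'
  refine ⟨hR₂.of_frame fun c hc' => ?_, hE₂.of_frame fun c hc' hc'' => ?_, ?_, ?_, ?_, ?_,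
    fun c hc' => ?data⟩
  case data =>
    (try simp (disch := first | omega | decide) only [merge_apply_of_le])
    rw [sD c hc', g.fillData_row _ hmd, show l * g.N + a + 1 = l * g.N + (a + 1) by omega]
  · rw [merge_apply_of_lt (by omega)]; simp (disch := omega) only [Function.update_of_ne]
  · rw [merge_apply_of_lt (by omega)]; simp (disch := omega) only [Function.update_of_ne]
  all_goals (try simp (disch := first | omega | decide) only [merge_apply_of_lt,
    Function.update_self, Function.update_of_ne])
  all_goals first | assumption | omega

/-- **One row.** [folklore] -/
theorem rowBody_spec (hF : g.Fits W) (hk : 1 ≤ g.k) (hc : 1 ≤ g.c) {kw : ℕ}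
    (hw : g.φ.IsWidthLE kw) (hmd : g.m ≤ g.d) {l a : ℕ} (hl : l < g.k) (ha : a < g.N)
    {m : ℕ → ℕ} (hI : g.RowInv l a m) : Achieves W O rowBody m (g.RowInv l (a + 1)) (g.Trow kw) := by
  unfold rowBody Trow
  refine Achieves.mono (T := 8 + ((g.m * (Tcl kw + 2) + 1) + (2 + 0))) ?_ (fun _ h => h) (by omega)
  refine Achieves.seqs_cons (g.rowBody_init hF hk hc hl ha hI) fun m₁ h₁ => ?_
  refine Achieves.seqs_cons (R := g.ClauseInv l a g.m) ?_ fun m₂ h₂ =>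
    Achieves.seqs_cons (g.rowBody_finish hF hk hc hmd ha h₂) fun _ h => Achieves.seqs_nil h
  refine Achieves.whilenz g.m (Tcl kw) (fun j => g.ClauseInv l a j)
    (fun j hj m' hI => ⟨?_, g.clauseBody_spec hF hk hc hw hmd hl ha hj hI⟩) (fun m' hI => ?_) h₁
    (fun _ h => h) le_rfl
  · simp only [Operand.read, hI.r36]; omega
  · simp only [Operand.read, hI.r36]; omega

/-! ### The list loop and the tables -/

/-- The invariant of the list loop after `l` lists. [folklore] -/
structure ListInv (l : ℕ) (m : ℕ → ℕ) : Prop where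
  regs : g.Regs m
  eregs : g.ERegs m
  r30 : m 30 = l
  r31 : m 31 = g.k - l
  data : ∀ c, 100 ≤ c → m c = g.fillData (l * g.N) 0 c

/-- One list, the opening block: reset `a`. [folklore] -/
theorem listBody_init (hF : g.Fits W) (hk : 1 ≤ g.k) (hc : 1 ≤ g.c) {l : ℕ} {m : ℕ → ℕ}
    (hI : g.ListInv l m) :
    Achieves W O (block [(.band, r 32, im 0, im 0), (.band, r 33, r 5, r 5)]) m (g.RowInv l 0) 2 := by
  obtain ⟨hX, -⟩ := g.facts hF hk hc
  obtain ⟨hR, hE, r30, r31, hD⟩ := hI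
  have r5 := hR.r5
  refine achieves_block_of_eq (fun m' hm' => ?_) le_rfl
  simp (disch := first | omega | decide) only [execOps_cons, execOps_nil, execOp, Operand.write,
    Operand.read, merge_apply_of_lt, update_merge_of_lt, Function.update_of_ne, BinOp.eval_band,
    Nat.and_self, r5] at hm'
  subst hm'
  refine ⟨hR.of_frame fun c hc' => ?_, hE.of_frame fun c hc' hc'' => ?_, ?_, ?_, ?_, ?_,
    fun c hc' => ?data⟩
  case data =>
    (try simp (disch := first | omega | decide) only [merge_apply_of_le]); rw [Nat.add_zero]
    exact hD c hc'
  · rw [merge_apply_of_lt (by omega)]; simp (disch := omega) only [Function.update_of_ne]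
  · rw [merge_apply_of_lt (by omega)]; simp (disch := omega) only [Function.update_of_ne]
  · (try simp (disch := first | omega | decide) only [merge_apply_of_lt,
      Function.update_of_ne]); exact r30
  · (try simp (disch := first | omega | decide) only [merge_apply_of_lt,
      Function.update_of_ne]); exact r31
  · (try simp (disch := first | omega | decide) only [merge_apply_of_lt, Function.update_self,
      Function.update_of_ne])
  · (try simp (disch := first | omega | decide) only [merge_apply_of_lt,
      Function.update_self]); omega

/-- One list, the closing block: advance `l`. [folklore] -/
theorem listBody_finish (hF : g.Fits W) (hk : 1 ≤ g.k) (hc : 1 ≤ g.c) {l : ℕ} (hl : l < g.k)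
    {m : ℕ → ℕ} (h₂ : g.RowInv l g.N m) :
    Achieves W O (block [(.add, r 30, r 30, im 1), (.sub, r 31, r 31, im 1)]) m (g.ListInv (l + 1))
      2 := by
  obtain ⟨hX, hXLx, hBv, hSv, htop, hLyV, hPwV, hcMV, hmLx, hN2, hd1, hNNd, hdNd, hNdk, hLy, hNd,
    hNG, hdc, hPw1, hG1, hGN, hGdef, hk1⟩ := g.facts hF hk hc
  have hkW : g.k < 2 ^ W := by
    have : g.k ≤ g.Nd * g.k := Nat.le_mul_of_pos_left _ (by omega)
    omega
  obtain ⟨hR₂, hE₂, s30, s31, -, -, sD⟩ := h₂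
  refine achieves_block_of_eq (fun m' hm' => ?_) le_rfl
  simp (disch := first | omega | decide) only [execOps_cons, execOps_nil, execOp, Operand.write,
    Operand.read, merge_apply_of_lt, update_merge_of_lt, Function.update_of_ne,
    BinOp.eval_add_of_lt, BinOp.eval_sub_of_le, s30, s31] at hm'
  subst hm'
  refine ⟨hR₂.of_frame fun c hc' => ?_, hE₂.of_frame fun c hc' hc'' => ?_, ?_, ?_, fun c hc' => ?data⟩
  case data =>
    (try simp (disch := first | omega | decide) only [merge_apply_of_le])
    rw [sD c hc', show l * g.N + g.N = (l + 1) * g.N by ring]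
  · rw [merge_apply_of_lt (by omega)]; simp (disch := omega) only [Function.update_of_ne]
  · rw [merge_apply_of_lt (by omega)]; simp (disch := omega) only [Function.update_of_ne]
  · (try simp (disch := first | omega | decide) only [merge_apply_of_lt, Function.update_self,
      Function.update_of_ne])
  · (try simp (disch := first | omega | decide) only [merge_apply_of_lt,
      Function.update_self]); omega

/-- **One list.** [folklore] -/
theorem listBody_spec (hF : g.Fits W) (hk : 1 ≤ g.k) (hc : 1 ≤ g.c) {kw : ℕ}
    (hw : g.φ.IsWidthLE kw) (hmd : g.m ≤ g.d) {l : ℕ} (hl : l < g.k) {m : ℕ → ℕ}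
    (hI : g.ListInv l m) : Achieves W O listBody m (g.ListInv (l + 1)) (g.Tlist kw) := by
  unfold listBody Tlist
  refine Achieves.mono (T := 2 + ((g.N * (g.Trow kw + 2) + 1) + (2 + 0))) ?_ (fun _ h => h)
    (by omega)
  refine Achieves.seqs_cons (g.listBody_init hF hk hc hI) fun m₁ h₁ => ?_
  refine Achieves.seqs_cons (R := g.RowInv l g.N) ?_ fun m₂ h₂ =>
    Achieves.seqs_cons (g.listBody_finish hF hk hc hl h₂) fun _ h => Achieves.seqs_nil h
  refine Achieves.whilenz g.N (g.Trow kw) (fun a => g.RowInv l a)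
    (fun a ha m' hI => ⟨?_, g.rowBody_spec hF hk hc hw hmd hl ha hI⟩) (fun m' hI => ?_) h₁
    (fun _ h => h) le_rfl
  · simp only [Operand.read, hI.r33]; omega
  · simp only [Operand.read, hI.r33]; omega

/-- **The tables.** From the setup registers and the relocated data, `fill` writes the `k` tables
of the split instance into the emulated cells: the data becomes `fillData (k N) 0`. [folklore] -/
theorem fill_spec (hF : g.Fits W) (hk : 1 ≤ g.k) (hc : 1 ≤ g.c) {kw : ℕ} (hw : g.φ.IsWidthLE kw)
    (hmd : g.m ≤ g.d) {m : ℕ → ℕ} (hR : g.Regs m) (hE : g.ERegs m)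
    (hD : ∀ a, 100 ≤ a → m a = relocated g.x a) :
    Achieves W O (fill g.k) m (g.ListInv g.k) (g.Tfill kw) := by
  obtain ⟨hX, hXLx, hBv, hSv, htop, hLyV, hPwV, hcMV, hmLx, hN2, hd1, hNNd, hdNd, hNdk, hLy, hNd,
    hNG, hdc, hPw1, hG1, hGN, hGdef, hk1⟩ := g.facts hF hk hc
  have hkW : g.k < 2 ^ W := by
    have : g.k ≤ g.Nd * g.k := Nat.le_mul_of_pos_left _ (by omega)
    omega
  unfold fill Tfill
  refine Achieves.mono (T := 2 + ((g.k * (g.Tlist kw + 2) + 1) + 0)) ?_ (fun _ h => h) (by omega)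
  refine Achieves.seqs_cons (R := g.ListInv 0) ?_ fun m₁ h₁ => ?_
  · refine achieves_block_of_eq (fun m' hm' => ?_) le_rfl
    simp (disch := first | omega | decide) only [execOps_cons, execOps_nil, execOp, Operand.write,
      Operand.read, update_merge_of_lt, BinOp.eval_band, Nat.and_self] at hm'
    subst hm'
    refine ⟨hR.of_frame fun c hc' => ?_, hE.of_frame fun c hc' hc'' => ?_, ?_, ?_, fun c hc' => ?data⟩
    case data =>
      (try simp (disch := first | omega | decide) only [merge_apply_of_le])
      rw [Nat.zero_mul, g.fillData_zero_zero]; exact hD c hc'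
    · rw [merge_apply_of_lt (by omega)]; simp (disch := omega) only [Function.update_of_ne]
    · rw [merge_apply_of_lt (by omega)]; simp (disch := omega) only [Function.update_of_ne]
    · (try simp (disch := first | omega | decide) only [merge_apply_of_lt, Function.update_self,
        Function.update_of_ne])
    · (try simp (disch := first | omega | decide) only [merge_apply_of_lt,
        Function.update_self]); omega
  refine Achieves.seqs_cons ?_ (fun _ h => Achieves.seqs_nil h)
  refine Achieves.whilenz g.k (g.Tlist kw) (fun l => g.ListInv l)
    (fun l hl m' hI => ⟨?_, g.listBody_spec hF hk hc hw hmd hl hI⟩) (fun m' hI => ?_) h₁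
    (fun _ h => h) le_rfl
  · simp only [Operand.read, hI.r31]; omega
  · simp only [Operand.read, hI.r31]; omega

/-! ### The cells of the emulated input -/

/-- The emulated input has length `L_y`. [folklore] -/
theorem length_y : g.y.length = g.Ly := by
  unfold y Ly Nd
  rw [length_kOV_encode_splitInstance, ← g.N_eq, ← g.d_eq]
  ring

/-- Emulated cell `0`: the length `L_y`. [folklore] -/
theorem ycell_zero : g.ycell 0 = g.Ly % g.Pw := rfl

/-- Emulated cell `1`: `N`. [folklore] -/
theorem ycell_one : g.ycell 1 = g.N % g.Pw := by
  unfold ycell y; rw [if_neg one_ne_zero, List.getD_eq_getElem?_getD, kOV_encode_getElem?_zero]; rfl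

/-- Emulated cell `2`: `d`. [folklore] -/
theorem ycell_two : g.ycell 2 = g.d % g.Pw := by
  unfold ycell y; rw [if_neg (by norm_num), List.getD_eq_getElem?_getD, kOV_encode_getElem?_one]; rfl

/-- Emulated cell `q + 3`, `q < k N d`: the table cell `q`. [folklore] -/
theorem ycell_entry (hc : 1 ≤ g.c) {q : ℕ} (hq : q < g.Nd * g.k) :
    g.ycell (q + 3) = g.cellVal q := by
  have hd : 0 < g.d := g.one_le_d hc
  have hN : 0 < g.N := by have := g.two_le_N; omega
  have hqd : q / g.d < g.k * g.N := by
    refine Nat.div_lt_of_lt_mul ?_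
    calc q < g.Nd * g.k := hq
      _ = g.d * (g.k * g.N) := by unfold Nd; ring
  have hl : q / g.d / g.N < g.k := Nat.div_lt_of_lt_mul (by rwa [Nat.mul_comm] at hqd)
  have ha : q / g.d % g.N < g.N := Nat.mod_lt _ hN
  have hj : q % g.d < g.d := Nat.mod_lt _ hd
  have := kOV_encode_splitInstance_getElem?_entry g.φ g.k g.c hl (g.N_eq ▸ ha) (g.d_eq ▸ hj)
  rw [← g.N_eq, ← g.d_eq, Nat.div_add_mod' (q / g.d) g.N, Nat.add_assoc,
    Nat.div_add_mod' q g.d] at this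
  unfold ycell y cellVal
  rw [if_neg (by omega), List.getD_eq_getElem?_getD, show q + 3 - 1 = 2 + q by omega, this]
  rfl

/-- **The header written**: from the end of the tables, the three header cells make the data
final. [folklore] -/
theorem finData_header (hc : 1 ≤ g.c) {m : ℕ → ℕ}
    (hm : ∀ a, 100 ≤ a → m a = g.fillData (g.k * g.N) 0 a) (a : ℕ) (ha : 100 ≤ a) :
    Function.update (Function.update (Function.update m g.Bv (g.Ly % g.Pw))
      (g.Bv + 1) (g.N % g.Pw)) (g.Bv + 2) (g.d % g.Pw) a = g.finData a := by
  obtain ⟨hX, hBv, -⟩ := g.bases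
  have hLy : g.Nd * g.k + 2 = g.Ly := rfl
  have hkN : g.k * g.N * g.d = g.Nd * g.k := by unfold Nd; ring
  unfold finData
  by_cases h2 : a = g.Bv + 2
  · subst h2; rw [Function.update_self, if_neg (by omega), if_pos (by omega),
      Nat.add_sub_cancel_left, ycell_two]
  rw [Function.update_of_ne h2]
  by_cases h1 : a = g.Bv + 1
  · subst h1; rw [Function.update_self, if_neg (by omega), if_pos (by omega),
      Nat.add_sub_cancel_left, ycell_one]
  rw [Function.update_of_ne h1]
  by_cases h0 : a = g.Bv
  · subst h0; rw [Function.update_self, if_neg (by omega), if_pos (by omega), Nat.sub_self,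
      ycell_zero]
  rw [Function.update_of_ne h0, hm a ha]
  unfold fillData
  by_cases h3 : a < g.Bv
  · rw [if_pos (by omega), if_pos h3]
  rw [if_neg (by omega), if_neg h3]
  simp only [Nat.add_zero]
  rw [hkN]
  by_cases h7 : a - (g.Bv + 3) < g.Nd * g.k
  · rw [if_pos h7, if_pos (by omega), show a - g.Bv = (a - (g.Bv + 3)) + 3 by omega,
      g.ycell_entry hc h7]
  · rw [if_neg h7, if_neg (by omega)]

/-! ### The whole build -/

/-- The time of the build (for formulas of width `≤ kw`). [folklore] -/
def Tpre (kw : ℕ) : ℕ :=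
  7 * g.Lx + 15 + (Nat.size g.Ly * 4 + 1) + 15 + g.Tfill kw + 8 + 96

/-- The total time of the reduction program, given a time bound `T` for the `k`-OV program
(build, emulated run at `cstep = 38` target steps per source step, read-out and `halt`).
[folklore] -/
def Ttotal (kw T : ℕ) : ℕ := g.Tpre kw + cstep * T + 4

/-- **The word-size constant** of the reduction: with `W = kfit · (n + inputWidth x)` every
address and value of the run fits (`Params.fits` of `…KOVSplitReduction`). [folklore] -/
def kfit (k c kM cM : ℕ) : ℕ :=
  Nat.size (2 * c * k + 2 * cM + 111) + kM * Nat.size (c * k + 2) + 2 * kM + 3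

/-- **The build.** On the initial memory of the input `x = encodeCNFWords φ` (word size `W` with
`g.Fits W`, `k ≥ 1`, `c ≥ 1`, width `≤ kw`, `m ≤ d`), `pre` ends, within `Tpre` steps, in the
closed-form memory `finMem`: environment registers `Bv, Sv, 0, Pw`, all other registers `0`, and
the data `finData` (relocated input and the emulated `kOV k` input). [folklore] -/
theorem pre_spec (hF : g.Fits W) (hk : 1 ≤ g.k) (hc : 1 ≤ g.c) {kw : ℕ} (hw : g.φ.IsWidthLE kw)
    (hmd : g.m ≤ g.d) :
    Achieves W O (pre g.k g.c g.kM g.cM) (initFun g.x) (fun m => m = g.finMem) (g.Tpre kw) := by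
  obtain ⟨hX, hXLx, hBv, hSv, htop, hLyV, hPwV, hcMV, hmLx, hN2, hd1, hNNd, hdNd, hNdk, hLy, hNd,
    hNG, hdc, hPw1, hG1, hGN, hGdef, hk1⟩ := g.facts hF hk hc
  unfold pre Tpre
  refine Achieves.mono (T := 7 * g.Lx + (15 + ((Nat.size g.Ly * 4 + 1) + (15 +
    (g.Tfill kw + (8 + (96 + 0))))))) ?_ (fun _ h => h) (by omega)
  -- relocate
  refine Achieves.seqs_cons (R := fun m => m = relocated g.x) (T₁ := 7 * g.Lx)
    (fun qs => ⟨relocated g.x, 7 * g.Lx, le_rfl, ?_, rfl⟩) ?_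
  · have h2 := g.two_le_Lx
    have hLxdef : g.x.length = g.Lx := rfl
    exact relocate_exec (by omega) hF.input (by omega) qs
  rintro m rfl
  -- setup
  refine Achieves.seqs_cons (g.setup1_spec hF hk hc) ?_
  rintro m₁ ⟨hR₁, -, h21, h22, hD₁⟩
  refine Achieves.seqs_cons (CliqueRed.Params.sizeLoop_spec (O := O) h21 h22 (by omega)) ?_
  rintro m₂ ⟨s22, -, sf⟩
  have hR₂ : g.Regs m₂ := hR₁.of_frame fun a ha => sf a (by omega) (by omega)
  have hD₂ : ∀ a, 100 ≤ a → m₂ a = relocated g.x a := fun a ha => by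
    rw [sf a (by omega) (by omega), hD₁ a ha]
  refine Achieves.seqs_cons (g.setup3_spec hF hk hc hR₂ s22 hD₂) ?_
  rintro m₃ ⟨hR₃, hE₃, hD₃⟩
  -- tables
  refine Achieves.seqs_cons (g.fill_spec hF hk hc hw hmd hR₃ hE₃ hD₃) fun m₆ h₆ => ?_
  obtain ⟨hR₆, hE₆, -, -, hD₆⟩ := h₆
  -- header
  refine Achieves.seqs_cons (R := fun m₇ => g.Regs m₇ ∧ g.ERegs m₇ ∧ ∀ a,
    100 ≤ a → m₇ a = g.finData a) (T₁ := 8) ?_ ?_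
  · obtain ⟨r0, r2, r3, r4, r5, r6, r7, r8, r10⟩ := hR₆
    obtain ⟨r11, r12, r13⟩ := hE₆
    refine achieves_block_of_eq (fun m' hm' => ?_) le_rfl
    simp (disch := first | omega | decide) only [execOps_cons, execOps_nil, execOp, Operand.write,
      Operand.read, merge_apply_of_lt, update_merge_of_lt, update_merge_of_le,
      Function.update_self, Function.update_of_ne, BinOp.eval_add_of_lt, BinOp.eval_mod,
      BinOp.eval_band, Nat.and_self, r5, r6, r8, r10, r13] at hm'
    subst hm'
    refine ⟨⟨?_, ?_, ?_, ?_, ?_, ?_, ?_, ?_, ?_⟩, ⟨?_, ?_, ?_⟩, fun a ha => ?data⟩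
    case data =>
      (try simp (disch := first | omega | decide) only [merge_apply_of_le])
      exact g.finData_header hc hD₆ a ha
    all_goals (try simp (disch := first | omega | decide) only [merge_apply_of_lt,
      Function.update_of_ne])
    all_goals assumption
  rintro m₇ ⟨hR₇, hE₇, hD₇⟩
  -- clearing
  refine Achieves.seqs_cons (T₁ := 96) (T₂ := 0) ?_ fun _ h => Achieves.seqs_nil h
  refine Achieves.block ?_ (by rw [List.length_map, CliqueRed.length_clearedRegs])
  show execOps W m₇ (CliqueRed.clearedRegs.map fun i => ((.band, r i, im 0, im 0) : OpSpec)) =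
    g.finMem
  rw [CliqueRed.execOps_clear]
  funext a
  unfold finMem
  simp only [CliqueRed.mem_clearedRegs]
  by_cases ha : a < 100
  · rw [if_pos ha]
    by_cases h10 : a = 10; · subst h10; simp [hR₇.r10]
    by_cases h11 : a = 11; · subst h11; simp [hE₇.r11]
    by_cases h12 : a = 12; · subst h12; simp [hE₇.r12]
    by_cases h13 : a = 13; · subst h13; simp [hE₇.r13]
    rw [if_pos ⟨ha, by omega⟩, if_neg h10, if_neg h11, if_neg h13]
  · rw [if_neg (by omega), if_neg ha, hD₇ a (by omega)]

end Params

end KOVRed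

end Literature.Computability.FineGrained
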